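import Summits.HubbardSuperconductivity.HubbardLadder.Bounds.SectorTwistRatio
import Summits.HubbardSuperconductivity.HubbardLadder.Bounds.TiltedSumCauchyVariance
import Summits.HubbardSuperconductivity.HubbardLadder.Bounds.ComplexFugacityActivityAnalytic
import HarnessLib

/-!
# The variance of the particle number in the tilted sector ensemble is `O(|Λ_L|)`
# (bounds.tex Lemma 13.4, model part II and assembly)

HONEST FRAMING (cell pub-hubbard): ladder R1–R4 with certified numbers; no claim on H/H₀. Bounds
for model classes (the translation-invariant `t–t'` Hubbard torus at high temperature), no
materials claim. Imports parts F8c (`SectorTwistRatio`, #211.8), F8d (`TiltedSumCauchyVariance`,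
#211.9) and F8e (`ComplexFugacityActivityAnalytic`, #211.10) of LEAN FILING REQUEST #211.

Part F8f of the kernel device for bounds.tex Theorem 13 (N-sector form). With
`w_k = ttSectorWeight L β t' U k` the untwisted sector weights and `n = |Orb Λ_L|`, the tilted
variance `Var(s) = gcVar w n s` of the particle number is bounded by
`gcVar w n s ≤ (1 + 4a/r²) · |Λ_L|`
for every real base fugacity `s` at which the one-site smallness of part F3 holds on the disc
`|ζ - s| < r₁` (`0 < r < r₁ ≤ π/4`, arc parameter `c₀ ≤ cos r₁`): THEOREM
`gcVar_ttSectorWeight_le`. Ingredients: the complex model link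
`Zc(β,U,ζ/β; c_0) = Σ_k e^{ζk} w_k` (`Zc_div_eq_gcPowSumC`); the factorisation
`Zc = z^{|Λ|} Ξ(ρ^{ζ/β})` of part F3, written as `e^{g₁ + g₂}` with `g₁ = |Λ| log z(ζ)`,
`z(ζ) = 1 + 2e^{ζ} + e^{2ζ-βU}` (`Re z ≥ 1` for `|Im ζ| ≤ π/4`) and `g₂ = log Ξ` (part F8e); the
explicit real-axis bound `(log z)''(s) ≤ 1` (`atomic_logDeriv₂_le_one`); the free-energy bound
`‖g₂‖ ≤ a|Λ|` of part F8e; and the split Cauchy estimate of part F8d.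

References: bounds.tex §13 (Lemma 13.4); D. Ruelle, Statistical Mechanics: Rigorous Results
(1969) §3.4 [Ruelle1969]; R. Kotecký, D. Preiss, Comm. Math. Phys. 103 (1986) 491
[KoteckyPreiss1986]; D. Ueltschi, J. Stat. Phys. 95 (1999) 693, §2.3 [Ueltschi1999].
-/

noncomputable section

namespace Summit.HubbardSuperconductivity.HubbardLadder.Bounds

open Matrix Finset Complex Metric
open Literature.MathematicalPhysics.QuantumLattice
open Literature.Probability.LatticeModels

/-! ### The one-site partition function at complex fugacity `ζ = βμ` -/

section Atomic

/-- `z(v, ζ) = 1 + 2e^{ζ} + e^{2ζ - v}`: the one-site partition function in the fugacity variable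
`ζ = βμ` (`v = βU`). [programme definition: bounds.tex §13, Lemma 13.1 (c)] -/
def atomicZC (v : ℝ) (ζ : ℂ) : ℂ := 1 + 2 * cexp ζ + cexp (2 * ζ - v)

/-- `z'(v, ζ) = 2e^{ζ} + 2e^{2ζ - v}`. [this file] -/
def atomicZC₁ (v : ℝ) (ζ : ℂ) : ℂ := 2 * cexp ζ + 2 * cexp (2 * ζ - v)

/-- `z''(v, ζ) = 2e^{ζ} + 4e^{2ζ - v}`. [this file] -/
def atomicZC₂ (v : ℝ) (ζ : ℂ) : ℂ := 2 * cexp ζ + 4 * cexp (2 * ζ - v)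

/-- `z₀(β, U, ζ/β) = z(βU, ζ)`. [this file] -/
theorem atomicPartitionFn_div_eq_atomicZC (β U : ℝ) (hβ : β ≠ 0) (ζ : ℂ) :
    atomicPartitionFn (β : ℂ) (U : ℂ) (ζ / β) = atomicZC (β * U) ζ := by
  rw [atomicPartitionFn_div_eq β U hβ ζ, atomicZC]

/-- On the real axis `z(v, s)` is the real one-site partition function `atomicZ v s`. [this file] -/
theorem atomicZC_ofReal (v s : ℝ) : atomicZC v s = ((atomicZ v s : ℝ) : ℂ) := by
  unfold atomicZC atomicZ; push_cast; ring

/-- `z'(v, s)` is real on the real axis. [this file] -/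
theorem atomicZC₁_ofReal (v s : ℝ) :
    atomicZC₁ v s = ((2 * Real.exp s + 2 * Real.exp (2 * s - v) : ℝ) : ℂ) := by
  unfold atomicZC₁; push_cast; ring

/-- `z''(v, s)` is real on the real axis. [this file] -/
theorem atomicZC₂_ofReal (v s : ℝ) :
    atomicZC₂ v s = ((2 * Real.exp s + 4 * Real.exp (2 * s - v) : ℝ) : ℂ) := by
  unfold atomicZC₂; push_cast; ring

/-- `dz/dζ = z'`. [this file] -/
theorem hasDerivAt_atomicZC (v : ℝ) (ζ : ℂ) : HasDerivAt (atomicZC v) (atomicZC₁ v ζ) ζ := by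
  have h1 : HasDerivAt (fun x : ℂ => 2 * x - (v : ℂ)) 2 ζ := by
    simpa using ((hasDerivAt_id' ζ).const_mul (2 : ℂ)).sub_const (v : ℂ)
  have h : HasDerivAt (fun x : ℂ => 1 + 2 * cexp x + cexp (2 * x - (v : ℂ)))
      (0 + 2 * cexp ζ + cexp (2 * ζ - (v : ℂ)) * 2) ζ :=
    ((hasDerivAt_const ζ (1 : ℂ)).add ((Complex.hasDerivAt_exp ζ).const_mul 2)).add h1.cexp
  have h' : HasDerivAt (fun x : ℂ => 1 + 2 * cexp x + cexp (2 * x - (v : ℂ))) (atomicZC₁ v ζ) ζ :=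
    h.congr_deriv (by unfold atomicZC₁; ring)
  exact h'

/-- `dz'/dζ = z''`. [this file] -/
theorem hasDerivAt_atomicZC₁ (v : ℝ) (ζ : ℂ) : HasDerivAt (atomicZC₁ v) (atomicZC₂ v ζ) ζ := by
  have h1 : HasDerivAt (fun x : ℂ => 2 * x - (v : ℂ)) 2 ζ := by
    simpa using ((hasDerivAt_id' ζ).const_mul (2 : ℂ)).sub_const (v : ℂ)
  have h : HasDerivAt (fun x : ℂ => 2 * cexp x + 2 * cexp (2 * x - (v : ℂ)))
      (2 * cexp ζ + 2 * (cexp (2 * ζ - (v : ℂ)) * 2)) ζ :=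
    ((Complex.hasDerivAt_exp ζ).const_mul 2).add (h1.cexp.const_mul 2)
  have h' : HasDerivAt (fun x : ℂ => 2 * cexp x + 2 * cexp (2 * x - (v : ℂ))) (atomicZC₂ v ζ) ζ :=
    h.congr_deriv (by unfold atomicZC₂; ring)
  exact h'

/-- **`Re z(v, ζ) ≥ 1` on the strip `|Im ζ| ≤ π/4`** (both cosines are non-negative there).
[this file] -/
theorem one_le_atomicZC_re (v : ℝ) {ζ : ℂ} (hζ : |ζ.im| ≤ Real.pi / 4) : 1 ≤ (atomicZC v ζ).re := by
  have hab := abs_le.1 hζ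
  have hc1 : 0 ≤ Real.cos ζ.im :=
    Real.cos_nonneg_of_mem_Icc ⟨by linarith [Real.pi_pos], by linarith [Real.pi_pos]⟩
  have hc2 : 0 ≤ Real.cos (2 * ζ.im) := Real.cos_nonneg_of_mem_Icc ⟨by linarith, by linarith⟩
  have hre : (atomicZC v ζ).re =
      1 + 2 * (Real.exp ζ.re * Real.cos ζ.im) + Real.exp (2 * ζ.re - v) * Real.cos (2 * ζ.im) := by
    simp [atomicZC, Complex.exp_re, Complex.exp_im]
  rw [hre]
  nlinarith [mul_nonneg (Real.exp_pos ζ.re).le hc1, mul_nonneg (Real.exp_pos (2 * ζ.re - v)).le hc2]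

/-- `z(v, ζ) ≠ 0` on the strip `|Im ζ| ≤ π/4`. [this file] -/
theorem atomicZC_ne_zero (v : ℝ) {ζ : ℂ} (hζ : |ζ.im| ≤ Real.pi / 4) : atomicZC v ζ ≠ 0 := by
  intro h
  have := one_le_atomicZC_re v hζ
  rw [h, Complex.zero_re] at this
  linarith

/-- `z(v, ζ)` lies in the slit plane on the strip `|Im ζ| ≤ π/4`. [this file] -/
theorem atomicZC_mem_slitPlane (v : ℝ) {ζ : ℂ} (hζ : |ζ.im| ≤ Real.pi / 4) :
    atomicZC v ζ ∈ Complex.slitPlane :=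
  Complex.mem_slitPlane_iff.2 (Or.inl (by linarith [one_le_atomicZC_re v hζ]))

/-- **The real-axis bound `(log z)''(s) ≤ 1`**: with `e₁ = e^{s}`, `e₂ = e^{2s-v}`,
`z''z - (z')² = 2e₁ + 4e₂ + 2e₁e₂ ≤ z² = (1 + 2e₁ + e₂)²` since
`z² - (z''z - z'²) = (1 - e₂)² + 4e₁² + 2e₁ + 2e₁e₂ ≥ 0`. [this file; bounds.tex Lemma 13.4] -/
theorem atomic_logDeriv₂_le_one (v s : ℝ) :
    ((2 * Real.exp s + 4 * Real.exp (2 * s - v)) * atomicZ v s -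
        (2 * Real.exp s + 2 * Real.exp (2 * s - v)) * (2 * Real.exp s + 2 * Real.exp (2 * s - v))) /
      atomicZ v s ^ 2 ≤ 1 := by
  rw [div_le_one (pow_pos (atomicZ_pos v s) 2)]
  unfold atomicZ
  have he1 := Real.exp_pos s
  have he2 := Real.exp_pos (2 * s - v)
  nlinarith [sq_nonneg (1 - Real.exp (2 * s - v)), mul_pos he1 he2, sq_nonneg (Real.exp s)]

end Atomic

/-! ### The model: variance bound for the tilted sector weights -/

section Torus

variable {L : ℕ} [NeZero L]

/-- **Model link at complex fugacity, sector form**: `Zc(β,U,ζ/β; c_θ) = Σ_k e^{ζk} Z_k(θ)`.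
[this file; cf. part F8c `Zc_ofReal_div_eq_sum_ttSectorZ`] -/
theorem Zc_div_eq_sum_ttSectorZ (hL : 3 ≤ L) {β : ℝ} (hβ : β ≠ 0) (t' U θ : ℝ) (ζ : ℂ) :
    Zc (β : ℂ) (U : ℂ) (ζ / β) (ttFluxCoupling L β t' θ) =
      ∑ k ∈ Finset.range (Fintype.card (Orb (FermionTorus 2 L)) + 1),
        cexp (ζ * k) * ttSectorZ L β t' U θ k := by
  rw [← trace_fugacity_mul_gibbsWeight_hubbardTorusTT'Flux_eq_Zc hL hβ t' U θ ζ]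
  set G := gibbsWeight β (hubbardTorusTT'Flux L t' U θ) with hG
  have htr :
      ((diagonal fun x : Finset (Orb (FermionTorus 2 L)) => cexp (ζ * x.card)) * G).trace =
        ∑ x, cexp (ζ * x.card) * G x x := by
    simp [Matrix.trace, Matrix.diagonal_mul]
  rw [htr]
  have hfib := Finset.sum_fiberwise_of_maps_to
    (s := (Finset.univ : Finset (Finset (Orb (FermionTorus 2 L)))))
    (t := Finset.range (Fintype.card (Orb (FermionTorus 2 L)) + 1)) (g := fun x => x.card)
    (fun x _ => Finset.mem_range.2 (Nat.lt_succ_of_le (Finset.card_le_univ x)))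
    (fun x => cexp (ζ * x.card) * G x x)
  rw [← hfib]
  refine Finset.sum_congr rfl fun k _ => ?_
  rw [ttSectorZ_eq_sum, Finset.mul_sum]
  refine Finset.sum_congr rfl fun x hx => ?_
  rw [(Finset.mem_filter.1 hx).2]

/-- **Model link, untwisted**: `Zc(β,U,ζ/β; c_0) = Σ_k e^{ζk} w_k = gcPowSumC 0 w n ζ` with the
positive sector weights `w = ttSectorWeight L β t' U`, `n = |Orb Λ_L|`. [this file] -/
theorem Zc_div_eq_gcPowSumC (hL : 3 ≤ L) {β : ℝ} (hβ : β ≠ 0) (t' U : ℝ) (ζ : ℂ) :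
    Zc (β : ℂ) (U : ℂ) (ζ / β) (ttFluxCoupling L β t' 0) =
      gcPowSumC 0 (ttSectorWeight L β t' U) (Fintype.card (Orb (FermionTorus 2 L))) ζ := by
  rw [Zc_div_eq_sum_ttSectorZ hL hβ t' U 0 ζ, gcPowSumC]
  refine Finset.sum_congr rfl fun k hk => ?_
  rw [pow_zero, one_mul,
    ttSectorZ_eq_ofReal_re β t' U 0 (Nat.le_of_lt_succ (Finset.mem_range.1 hk))]
  rfl

/-- `|Im ζ| < r₁` on the disc `|ζ - s| < r₁` about a real centre `s`. [folklore] -/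
theorem abs_im_lt_of_mem_ball_ofReal {s r₁ : ℝ} {ζ : ℂ} (hζ : ζ ∈ ball (s : ℂ) r₁) :
    |ζ.im| < r₁ := by
  have h1 : |(ζ - (s : ℂ)).im| ≤ ‖ζ - (s : ℂ)‖ := Complex.abs_im_le_norm _
  rw [Complex.sub_im, Complex.ofReal_im, sub_zero] at h1
  exact h1.trans_lt (mem_ball_iff_norm.1 hζ)

/-- **THEOREM (variance bound; bounds.tex Lemma 13.4, N-sector device input (D3)).** Let `L ≥ 3`,
`β ≠ 0`, real `t', U, s`; arc and floor parameters `0 ≤ c₀`, `|βU| ≤ u₀`, `R > 0` with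
`R² (1 - (1-c₀)/2 - (1-c₀²)/(1+e^{-u₀/2})²) ≥ 1`; `a, δ > 0` with the one-site smallness
`16 S e^{2S} (R e^{a+δ} + a)² ≤ a` (`S = |β|(1+|t'|)`); radii `0 < r < r₁ ≤ π/4` with
`c₀ ≤ cos r₁`. Then the tilted variance of the particle number in the untwisted sector ensemble
obeys `gcVar w n s ≤ (1 + 4a/r²) |Λ_L|` (`w = ttSectorWeight L β t' U`, `n = |Orb Λ_L|`).
[programme: bounds.tex §13, Lemma 13.4; this file] -/
theorem gcVar_ttSectorWeight_le (hL : 3 ≤ L) {β : ℝ} (hβ : β ≠ 0) (t' U s : ℝ)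
    {c₀ u₀ R a δ r r₁ : ℝ} (hc₀ : 0 ≤ c₀) (hv : |β * U| ≤ u₀) (hR : 0 < R)
    (hfloor : 1 ≤ R ^ 2 * (1 - (1 - c₀) / 2 - (1 - c₀ ^ 2) / (1 + Real.exp (-(u₀ / 2))) ^ 2))
    (ha : 0 < a) (hδ : 0 < δ)
    (hsmall : 16 * (|β| * (1 + |t'|)) * Real.exp (2 * (|β| * (1 + |t'|))) *
      (R * Real.exp (a + δ) + a) ^ 2 ≤ a)
    (hr : 0 < r) (hrr₁ : r < r₁) (hr₁ : r₁ ≤ Real.pi / 4) (hc₀r : c₀ ≤ Real.cos r₁) :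
    gcVar (ttSectorWeight L β t' U) (Fintype.card (Orb (FermionTorus 2 L))) s ≤
      (1 + 4 * a / r ^ 2) * Fintype.card (FermionTorus 2 L) := by
  have hw : ∀ k ≤ Fintype.card (Orb (FermionTorus 2 L)), 0 < ttSectorWeight L β t' U k :=
    fun k hk => ttSectorWeight_pos β t' U hk
  have hs : (s : ℂ) ∈ ball (s : ℂ) r₁ := mem_ball_self (hr.trans hrr₁)
  -- geometry of the disc: inside the strip and on the arc
  have hpi4 : ∀ ζ ∈ ball (s : ℂ) r₁, |ζ.im| ≤ Real.pi / 4 :=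
    fun ζ hζ => (abs_im_lt_of_mem_ball_ofReal hζ).le.trans hr₁
  have hcos : ∀ ζ ∈ ball (s : ℂ) r₁, c₀ ≤ Real.cos ζ.im := fun ζ hζ => by
    rw [← Real.cos_abs]
    exact hc₀r.trans (Real.cos_le_cos_of_nonneg_of_le_pi (abs_nonneg _)
      (by linarith [Real.pi_pos]) (abs_im_lt_of_mem_ball_ofReal hζ).le)
  have hz : ∀ ζ ∈ ball (s : ℂ) r₁, atomicPartitionFn (β : ℂ) (U : ℂ) (ζ / β) ≠ 0 := fun ζ hζ => by
    rw [atomicPartitionFn_div_eq_atomicZC β U hβ]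
    exact atomicZC_ne_zero _ (hpi4 ζ hζ)
  have hsmallζ : ∀ ζ ∈ ball (s : ℂ) r₁,
      16 * (|β| * (1 + |t'|)) * Real.exp (2 * (|β| * (1 + |t'|))) *
        (siteRatio (β : ℂ) (U : ℂ) (ζ / β) * Real.exp (a + δ) + a) ^ 2 ≤ a := fun ζ hζ => by
    have hsr : siteRatio (β : ℂ) (U : ℂ) (ζ / β) ≤ R :=
      siteRatio_le_of_arc β U hβ ζ c₀ u₀ R hc₀ (hcos ζ hζ) (abs_le.1 hv).1 hR hfloor
    have hr0 : 0 ≤ siteRatio (β : ℂ) (U : ℂ) (ζ / β) := siteRatio_nonneg _ _ _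
    exact le_trans (mul_le_mul_of_nonneg_left (pow_le_pow_left₀ (by positivity)
      (by nlinarith [Real.exp_pos (a + δ)]) 2) (by positivity)) hsmall
  -- the two logarithms
  obtain ⟨g₁, hg₁_def⟩ : ∃ g : ℂ → ℂ, g = fun ζ : ℂ =>
      (Fintype.card (FermionTorus 2 L) : ℂ) * Complex.log (atomicZC (β * U) ζ) := ⟨_, rfl⟩
  obtain ⟨g₂, hg₂_def⟩ : ∃ g : ℂ → ℂ, g = fun ζ : ℂ =>
      polymerLogZ polyInc (ttActivityMu L β t' U (ζ / β) 0)
        (Finset.univ : Finset (FermionTorus 2 L)).powerset := ⟨_, rfl⟩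
  have hg₂ : DifferentiableOn ℂ g₂ (ball (s : ℂ) r₁) := by
    rw [hg₂_def]
    exact differentiableOn_polymerLogZ_ttActivityMu hL β t' U 0 isOpen_ball hz ha hδ hsmallζ
  have hd₁ : ∀ ζ ∈ ball (s : ℂ) r₁, HasDerivAt g₁ ((Fintype.card (FermionTorus 2 L) : ℂ) *
      (atomicZC₁ (β * U) ζ / atomicZC (β * U) ζ)) ζ := fun ζ hζ => by
    rw [hg₁_def]
    exact ((hasDerivAt_atomicZC (β * U) ζ).clog (atomicZC_mem_slitPlane _ (hpi4 ζ hζ))).const_mul _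
  have hg₁ : DifferentiableOn ℂ g₁ (ball (s : ℂ) r₁) :=
    fun ζ hζ => (hd₁ ζ hζ).differentiableAt.differentiableWithinAt
  -- `g₁''(s) = |Λ| (z''z - z'²)/z² (s)`, real and `≤ |Λ|`
  have hdd : deriv (deriv g₁) (s : ℂ) = (Fintype.card (FermionTorus 2 L) : ℂ) *
      ((atomicZC₂ (β * U) s * atomicZC (β * U) s - atomicZC₁ (β * U) s * atomicZC₁ (β * U) s) /
        atomicZC (β * U) s ^ 2) := by
    have heq : deriv g₁ =ᶠ[nhds (s : ℂ)] fun ζ => (Fintype.card (FermionTorus 2 L) : ℂ) *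
        (atomicZC₁ (β * U) ζ / atomicZC (β * U) ζ) :=
      Filter.eventuallyEq_of_mem (isOpen_ball.mem_nhds hs) fun ζ hζ => (hd₁ ζ hζ).deriv
    rw [heq.deriv_eq]
    exact (((hasDerivAt_atomicZC₁ (β * U) (s : ℂ)).div (hasDerivAt_atomicZC (β * U) (s : ℂ))
      (atomicZC_ne_zero _ (hpi4 _ hs))).const_mul _).deriv
  have hD : (deriv (deriv g₁) (s : ℂ)).re ≤ Fintype.card (FermionTorus 2 L) := by
    rw [hdd, atomicZC_ofReal, atomicZC₁_ofReal, atomicZC₂_ofReal]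
    have hcast : (Fintype.card (FermionTorus 2 L) : ℂ) *
        ((((2 * Real.exp s + 4 * Real.exp (2 * s - β * U) : ℝ) : ℂ) *
              ((atomicZ (β * U) s : ℝ) : ℂ) -
            ((2 * Real.exp s + 2 * Real.exp (2 * s - β * U) : ℝ) : ℂ) *
              ((2 * Real.exp s + 2 * Real.exp (2 * s - β * U) : ℝ) : ℂ)) /
          ((atomicZ (β * U) s : ℝ) : ℂ) ^ 2) =
        (((Fintype.card (FermionTorus 2 L) : ℝ) *
          (((2 * Real.exp s + 4 * Real.exp (2 * s - β * U)) * atomicZ (β * U) s -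
              (2 * Real.exp s + 2 * Real.exp (2 * s - β * U)) *
                (2 * Real.exp s + 2 * Real.exp (2 * s - β * U))) /
            atomicZ (β * U) s ^ 2) : ℝ) : ℂ) := by
      push_cast; ring
    rw [hcast, Complex.ofReal_re]
    have hq := atomic_logDeriv₂_le_one (β * U) s
    have hm : (0 : ℝ) ≤ Fintype.card (FermionTorus 2 L) := Nat.cast_nonneg _
    nlinarith
  -- `e^{g₁ + g₂} = Zc = Σ e^{ζk} w_k` on the disc
  have hexp : ∀ ζ ∈ ball (s : ℂ) r₁, cexp (g₁ ζ + g₂ ζ) =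
      gcPowSumC 0 (ttSectorWeight L β t' U) (Fintype.card (Orb (FermionTorus 2 L))) ζ := by
    intro ζ hζ
    have hS := isSmallActivityA_ttActivityMu hL β t' U 0 (hz ζ hζ) ha hδ (hsmallζ ζ hζ)
    simp only [hg₁_def, hg₂_def]
    rw [Complex.exp_add, Complex.exp_nat_mul, Complex.exp_log (atomicZC_ne_zero _ (hpi4 ζ hζ)),
      hS.exp_polymerLogZ, ← atomicPartitionFn_div_eq_atomicZC β U hβ ζ,
      ← Zc_ttFluxCoupling_eq_mul_polymerPartitionFunction_complexMu hL β t' U 0 (hz ζ hζ),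
      Zc_div_eq_gcPowSumC hL hβ t' U ζ]
  -- the oscillation of `g₂` on the circle: twice the free-energy bound
  have hC : ∀ ζ ∈ sphere (s : ℂ) r, ‖g₂ ζ - g₂ s‖ ≤ 2 * (a * Fintype.card (FermionTorus 2 L)) := by
    intro ζ hζ
    have hζ' : ζ ∈ ball (s : ℂ) r₁ :=
      (sphere_subset_closedBall.trans (closedBall_subset_ball hrr₁)) hζ
    simp only [hg₂_def]
    have h1 := norm_polymerLogZ_ttActivityMu_le hL β t' U 0 (hz ζ hζ') ha hδ (hsmallζ ζ hζ')
    have h2 := norm_polymerLogZ_ttActivityMu_le hL β t' U 0 (hz _ hs) ha hδ (hsmallζ _ hs)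
    exact (norm_sub_le _ _).trans (by linarith)
  -- the split Cauchy estimate (part F8d)
  have h := gcVar_le_of_exp_add_eq hw s hr hrr₁ hg₁ hg₂ hexp hD hC
  calc gcVar (ttSectorWeight L β t' U) (Fintype.card (Orb (FermionTorus 2 L))) s
      ≤ Fintype.card (FermionTorus 2 L) +
          2 * (2 * (a * Fintype.card (FermionTorus 2 L))) / r ^ 2 := h
    _ = (1 + 4 * a / r ^ 2) * Fintype.card (FermionTorus 2 L) := by ring

end Torus

end Summit.HubbardSuperconductivity.HubbardLadder.Bounds

end
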